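import Summits.MatrixMultiplication.MatrixMultiplication.Theorems.FarEdgeDescentSmoothCut
import Mathlib.Analysis.SpecialFunctions.ExpDeriv
import HarnessLib

/-!
# Route `FarEdgeDescent` — model worlds of the REGULARITY CUT `ω(ℂ) = 2 ⟺ TameProfile ∧ SmoothProfile`

Support module (def-free) for the asides `SmoothProfile` (stmt-MatrixMultiplication-27850, gen 21) and
`TameProfile` (stmt-MatrixMultiplication-31917): four EXPLICIT model profiles `F : ℝ → ℝ` (statements about
these functions, not about `ω`; «`P`-shape» = the route statement `P` with `ω(1,·,1)` replaced by `F`), which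
place the regularity cut of `FarEdgeDescentSmoothCut` against the cut of record
(`FiniteSaturation`, `AnchoredLogConvexity`):

* `tangentialWorld`  `F(x) = x + 1 + (2−x)₊²/4` — convex, excess antitone and ½-Lipschitz, last zero `2` reached
  TANGENTIALLY: `ω > 2`-shape ∧ `FiniteSaturation`-shape ∧ `SmoothProfile`-shape (everywhere differentiable;
  at `2` by `hasDerivAt_iff_isLittleO`) ∧ ¬`AnchoredLogConvexity`-shape.  So (`FiniteSaturation`,
  `SmoothProfile`) is NOT a cut — the regularity leaf needs the STRONGER special leaf `TameProfile` — and
  `SmoothProfile ⊬ AnchoredLogConvexity` in worlds.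
* `kinkedWorld`  `F(x) = x + 1 + max(e^{−2(x−1)}, e^{−(x−1)−1/2})` — zero-free, `log`-excess convex with a
  corner at `3/2`: `AnchoredLogConvexity`-shape ∧ ¬`SmoothProfile`-shape (left quotients `≤ 1 − 2/e`, right
  quotients `≥ 1 − 1/e`, by `e^t ≥ 1 + t`).  So `AnchoredLogConvexity ⊬ SmoothProfile`: the two generic
  leaves are INCOMPARABLE.
* `darkVertexWorld`  `F(x) = x + 1 + (2−x)₊ = max(3, x+1)` — `TameProfile`-shape (two affine pieces) ∧
  `FiniteSaturation`-shape ∧ a TRANSVERSAL contact at `b = 2` (slope `0`) ∧ ¬`SmoothProfile`-shape: the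
  generic leaf is load-bearing, and this is the world it kills.
* `roundWorld`  `F(x) = x + 1 + e^{−(x−1)}` — `SmoothProfile`-shape ∧ ¬`TameProfile`-shape (an exponential is
  not eventually affine: second differences `E₀(1 − e^{−1})² ≠ 0`; via the landed
  `FarEdgeDescentTameProfile.exists_eventual_dominator`): the special leaf is load-bearing.

All four obey the proved profile laws they are compared under (excess `≥ 0`, antitone, 1-Lipschitz, convex).
Written by the decomp-mm lens-2 planner seat (gen 21); imports only BUILT modules, restates nothing.
-/

set_option linter.dupNamespace false

noncomputable section

namespace Summit.MatrixMultiplication.MatrixMultiplication.Theorems.FarEdgeDescentSmoothWorlds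

open Summit.MatrixMultiplication.MatrixMultiplication.Theorems.FarEdgeDescentTameProfile
open Summit.MatrixMultiplication.MatrixMultiplication.Theorems.FarEdgeDescentSmoothCut
open Filter Topology Set Asymptotics


/-- **Tangential world** `F(x) = x + 1 + (2−x)₊²/4` (convex, excess antitone and 1-Lipschitz, last zero
`2` reached TANGENTIALLY): `ω > 2`-shape, `FiniteSaturation`-shape, `SmoothProfile`-shape (everywhere
differentiable) and NOT `AnchoredLogConvexity`-shape (at `m = 3/2`: `(1/16)² > (1/4)·0`).  Hence
(`FiniteSaturation`, `SmoothProfile`) is NOT a cut, and `SmoothProfile ⊬ AnchoredLogConvexity` in worlds. -/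
theorem tangentialWorld :
    (2 < (fun x : ℝ => x + 1 + max (2 - x) 0 ^ 2 / 4) 1) ∧
    ((fun x : ℝ => x + 1 + max (2 - x) 0 ^ 2 / 4) 2 = 2 + 1) ∧
    (∀ x : ℝ, DifferentiableAt ℝ (fun x : ℝ => x + 1 + max (2 - x) 0 ^ 2 / 4) x) ∧
    ¬ (∀ m : ℝ, 1 < m →
      ((fun x : ℝ => x + 1 + max (2 - x) 0 ^ 2 / 4) m - (m + 1)) ^ 2 ≤
        ((fun x : ℝ => x + 1 + max (2 - x) 0 ^ 2 / 4) 1 - 2) *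
          ((fun x : ℝ => x + 1 + max (2 - x) 0 ^ 2 / 4) (2 * m - 1) - 2 * m)) := by
  refine ⟨by norm_num, by norm_num, fun x => ?_, fun h => ?_⟩
  · refine DifferentiableAt.add (by fun_prop) (DifferentiableAt.div_const ?_ 4)
    rcases lt_trichotomy x 2 with hx | hx | hx
    · have hev : (fun y : ℝ => max (2 - y) 0 ^ 2) =ᶠ[𝓝 x] fun y : ℝ => (2 - y) ^ 2 := by
        filter_upwards [Iio_mem_nhds hx] with y hy
        rw [max_eq_left (by linarith [mem_Iio.1 hy])]
      exact (show DifferentiableAt ℝ (fun y : ℝ => (2 - y) ^ 2) x by fun_prop).congr_of_eventuallyEq hev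
    · subst hx
      have hlo : (fun y : ℝ => max (2 - y) 0 ^ 2 - max (2 - (2 : ℝ)) 0 ^ 2 - (y - 2) • (0 : ℝ))
          =o[𝓝 (2 : ℝ)] fun y => y - 2 := by
        refine IsBigO.trans_isLittleO (g := fun y : ℝ => ‖y - 2‖ ^ 2) ?_ (isLittleO_pow_sub_sub 2 one_lt_two)
        refine IsBigO.of_bound 1 ?_
        filter_upwards with y
        have h0 : 0 ≤ max (2 - y) 0 := le_max_right _ _
        have h1 : max (2 - y) 0 ≤ |y - 2| :=
          max_le (by rw [abs_sub_comm]; exact le_abs_self _) (abs_nonneg _)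
        have h2 : max (2 - y) 0 ^ 2 ≤ |y - 2| ^ 2 := pow_le_pow_left₀ h0 h1 2
        simp only [sub_self, max_self, ne_eq, OfNat.ofNat_ne_zero, not_false_eq_true, zero_pow, sub_zero,
          smul_zero, one_mul, norm_pow, Real.norm_eq_abs, abs_abs]
        rw [abs_of_nonneg h0]
        exact h2
      exact (hasDerivAt_iff_isLittleO.2 hlo).differentiableAt
    · have hev : (fun y : ℝ => max (2 - y) 0 ^ 2) =ᶠ[𝓝 x] fun _ : ℝ => (0 : ℝ) := by
        filter_upwards [Ioi_mem_nhds hx] with y hy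
        rw [max_eq_right (by linarith [mem_Ioi.1 hy])]
        ring
      exact (differentiableAt_const (0 : ℝ)).congr_of_eventuallyEq hev
  · have h1 := h (3 / 2) (by norm_num)
    norm_num at h1

/-- **Kinked log-convex world** `F(x) = x + 1 + max(e^{−2(x−1)}, e^{−(x−1)−1/2})` (zero-free, `log E` convex
with a corner at `x = 3/2`): `AnchoredLogConvexity`-shape holds, `SmoothProfile`-shape FAILS (left quotients
`≤ 1 − 2/e`, right quotients `≥ 1 − 1/e` at `3/2`).  Hence `AnchoredLogConvexity ⊬ SmoothProfile` in worlds: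
the two generic leaves are INCOMPARABLE. -/
theorem kinkedWorld :
    (∀ m : ℝ, 1 < m →
      ((fun x : ℝ => x + 1 + max (Real.exp (-2 * (x - 1))) (Real.exp (-(x - 1) - 1 / 2))) m - (m + 1)) ^ 2 ≤
        ((fun x : ℝ => x + 1 + max (Real.exp (-2 * (x - 1))) (Real.exp (-(x - 1) - 1 / 2))) 1 - 2) *
          ((fun x : ℝ => x + 1 + max (Real.exp (-2 * (x - 1))) (Real.exp (-(x - 1) - 1 / 2))) (2 * m - 1)
            - 2 * m)) ∧
    ¬ DifferentiableAt ℝ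
        (fun x : ℝ => x + 1 + max (Real.exp (-2 * (x - 1))) (Real.exp (-(x - 1) - 1 / 2))) (3 / 2) := by
  constructor
  · intro m hm
    have hE1 : max (Real.exp (-2 * ((1 : ℝ) - 1))) (Real.exp (-((1 : ℝ) - 1) - 1 / 2)) = 1 := by
      rw [sub_self, mul_zero, neg_zero, zero_sub, Real.exp_zero]
      exact max_eq_left (Real.exp_le_one_iff.2 (by norm_num))
    simp only [add_sub_cancel_left]
    rw [show (1 : ℝ) + 1 + max (Real.exp (-2 * ((1 : ℝ) - 1))) (Real.exp (-((1 : ℝ) - 1) - 1 / 2)) - 2 = 1 by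
      rw [hE1]; ring, one_mul,
      show (2 * m - 1 + 1 + max (Real.exp (-2 * (2 * m - 1 - 1))) (Real.exp (-(2 * m - 1 - 1) - 1 / 2))
        - 2 * m) = max (Real.exp (-2 * (2 * m - 1 - 1))) (Real.exp (-(2 * m - 1 - 1) - 1 / 2)) by ring]
    rcases le_total (Real.exp (-2 * (m - 1))) (Real.exp (-(m - 1) - 1 / 2)) with hle | hle
    · rw [max_eq_right hle, sq, ← Real.exp_add]
      exact le_trans (Real.exp_le_exp.2 (by linarith)) (le_max_right _ _)
    · rw [max_eq_left hle, sq, ← Real.exp_add]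
      exact le_trans (Real.exp_le_exp.2 (by linarith)) (le_max_left _ _)
  · have hb : max (Real.exp (-2 * ((3 : ℝ) / 2 - 1))) (Real.exp (-((3 : ℝ) / 2 - 1) - 1 / 2)) = Real.exp (-1) := by
      norm_num
    refine not_differentiableAt_of_slope_gap (a := 1 - 2 * Real.exp (-1)) (a' := 1 - Real.exp (-1))
      (by linarith [Real.exp_pos (-1)]) ?_ ?_
    · filter_upwards [self_mem_nhdsWithin] with x hx
      have hx' : x < 3 / 2 := hx
      rw [slope_def_field, hb]
      have hxb : x - 3 / 2 < 0 := by linarith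
      rw [div_le_iff_of_neg hxb]
      have h1 : Real.exp (-2 * (x - 1)) ≤ max (Real.exp (-2 * (x - 1))) (Real.exp (-(x - 1) - 1 / 2)) :=
        le_max_left _ _
      -- `e^{−2(x−1)} = e^{−1}·e^{2(3/2−x)} ≥ e^{−1}(1 + 2(3/2−x))`
      have h2 : Real.exp (-1) * (1 + 2 * (3 / 2 - x)) ≤ Real.exp (-2 * (x - 1)) := by
        have h3 := Real.add_one_le_exp (2 * (3 / 2 - x))
        have h4 : Real.exp (-2 * (x - 1)) = Real.exp (-1) * Real.exp (2 * (3 / 2 - x)) := by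
          rw [← Real.exp_add]; ring_nf
        rw [h4]
        exact mul_le_mul_of_nonneg_left (by linarith) (Real.exp_pos _).le
      nlinarith [Real.exp_pos (-1)]
    · filter_upwards [self_mem_nhdsWithin] with y hy
      have hy' : 3 / 2 < y := hy
      rw [slope_def_field, hb]
      have hyb : 0 < y - 3 / 2 := by linarith
      rw [le_div_iff₀ hyb]
      have h1 : Real.exp (-(y - 1) - 1 / 2) ≤ max (Real.exp (-2 * (y - 1))) (Real.exp (-(y - 1) - 1 / 2)) :=
        le_max_right _ _
      -- `e^{−(y−1)−1/2} = e^{−1}·e^{−(y−3/2)} ≥ e^{−1}(1 − (y − 3/2))`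
      have h2 : Real.exp (-1) * (1 - (y - 3 / 2)) ≤ Real.exp (-(y - 1) - 1 / 2) := by
        have h3 := Real.add_one_le_exp (-(y - 3 / 2))
        have h4 : Real.exp (-(y - 1) - 1 / 2) = Real.exp (-1) * Real.exp (-(y - 3 / 2)) := by
          rw [← Real.exp_add]; ring_nf
        rw [h4]
        exact mul_le_mul_of_nonneg_left (by linarith) (Real.exp_pos _).le
      nlinarith [Real.exp_pos (-1)]

/-- **One-dark-vertex (tame) world** `F(x) = x + 1 + (2−x)₊ = max(3, x+1)`: `TameProfile`-shape (two affine
pieces), `FiniteSaturation`-shape, a TRANSVERSAL contact at `b = 2` (slope `a = 0`), hence NOT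
`SmoothProfile`-shape — the generic leaf is load-bearing in the regularity cut, and this is the world it kills. -/
theorem darkVertexWorld :
    (∀ m : ℝ, 1 ≤ m → IsGreatest (Set.range fun i : Fin (1 + 1) => ![(0 : ℝ), 1] i * m + ![(3 : ℝ), 1] i)
      ((fun x : ℝ => x + 1 + max (2 - x) 0) m)) ∧
    ((fun x : ℝ => x + 1 + max (2 - x) 0) 2 = 2 + 1) ∧
    (∀ x : ℝ, 1 ≤ x → x ≤ 2 → (fun x : ℝ => x + 1 + max (2 - x) 0) 2 - 0 * (2 - x) ≤
      (fun x : ℝ => x + 1 + max (2 - x) 0) x) ∧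
    ¬ DifferentiableAt ℝ (fun x : ℝ => x + 1 + max (2 - x) 0) 2 := by
  refine ⟨fun m hm => ⟨?_, ?_⟩, by norm_num, fun x hx hx2 => ?_, ?_⟩
  · rcases le_total m 2 with h | h
    · exact ⟨0, by simp [max_eq_left (sub_nonneg.2 h)]; ring⟩
    · exact ⟨1, by simp [max_eq_right (sub_nonpos.2 h)]⟩
  · rintro _ ⟨i, rfl⟩
    fin_cases i
    · show (0 : ℝ) * m + 3 ≤ m + 1 + max (2 - m) 0
      linarith [le_max_left (2 - m) 0]
    · show (1 : ℝ) * m + 1 ≤ m + 1 + max (2 - m) 0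
      linarith [le_max_right (2 - m) 0]
  · simp only [sub_self, max_self, add_zero, zero_mul, sub_zero]
    linarith [le_max_left (2 - x) 0]
  · refine not_differentiableAt_of_slope_gap (a := 0) (a' := 1) zero_lt_one ?_ ?_
    · filter_upwards [self_mem_nhdsWithin] with x hx
      have hx' : x < 2 := hx
      rw [slope_def_field, max_eq_left (by linarith : (0 : ℝ) ≤ 2 - x), sub_self, max_self,
        div_le_iff_of_neg (by linarith)]
      linarith
    · filter_upwards [self_mem_nhdsWithin] with y hy
      have hy' : 2 < y := hy
      rw [slope_def_field, max_eq_right (by linarith : 2 - y ≤ 0), sub_self, max_self, le_div_iff₀ (by linarith)]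
      linarith

/-- **Round smooth world** `F(x) = x + 1 + e^{−(x−1)}` (zero-free): `SmoothProfile`-shape holds (and the
anchored law with equality) but `TameProfile`-shape FAILS (an exponential is not eventually affine: second
differences `E₀(1 − e^{−1})² ≠ 0`) — the special leaf is load-bearing in the regularity cut. -/
theorem roundWorld :
    (∀ x : ℝ, DifferentiableAt ℝ (fun x : ℝ => x + 1 + Real.exp (-(x - 1))) x) ∧
    ¬ (∃ N : ℕ, ∃ α β : Fin (N + 1) → ℝ, ∀ m : ℝ, 1 ≤ m →
        IsGreatest (Set.range fun i : Fin (N + 1) => α i * m + β i)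
          ((fun x : ℝ => x + 1 + Real.exp (-(x - 1))) m)) := by
  refine ⟨fun x => by fun_prop, ?_⟩
  rintro ⟨N, α, β, hT⟩
  obtain ⟨i₀, M, hdom⟩ := exists_eventual_dominator α β
  have haff : ∀ m : ℝ, max M 1 ≤ m → m + 1 + Real.exp (-(m - 1)) = α i₀ * m + β i₀ := by
    intro m hm
    have hm1 : 1 ≤ m := le_trans (le_max_right _ _) hm
    have hmM : M ≤ m := le_trans (le_max_left _ _) hm
    obtain ⟨⟨j, hj⟩, hub⟩ := hT m hm1
    apply le_antisymm
    · have := hdom m hmM j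
      simp only at hj
      linarith
    · exact hub ⟨i₀, rfl⟩
  set M₁ : ℝ := max M 1 with hM₁
  have h0 := haff M₁ le_rfl
  have h1 := haff (M₁ + 1) (by linarith)
  have h2 := haff (M₁ + 2) (by linarith)
  have e1 : Real.exp (-(M₁ + 1 - 1)) = Real.exp (-(M₁ - 1)) * Real.exp (-1) := by
    rw [← Real.exp_add]; ring_nf
  have e2 : Real.exp (-(M₁ + 2 - 1)) = Real.exp (-(M₁ - 1)) * Real.exp (-1) * Real.exp (-1) := by
    rw [← Real.exp_add, ← Real.exp_add]; ring_nf
  rw [e1] at h1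
  rw [e2] at h2
  have hq : Real.exp (-(M₁ - 1)) * (1 - Real.exp (-1)) ^ 2 = 0 := by nlinarith
  rcases mul_eq_zero.1 hq with h | h
  · exact (Real.exp_pos _).ne' h
  · have : Real.exp (-1) = 1 := by nlinarith [Real.exp_pos (-1 : ℝ)]
    rw [Real.exp_eq_one_iff] at this
    norm_num at this

/-- **Summary of the four worlds as separations** (pure bookkeeping of the conjunctions above): the
tangential world refutes «`FiniteSaturation`-shape ∧ `Smooth`-shape ⟹ `AnchoredLogConvexity`-shape», the kinked
world refutes «`AnchoredLogConvexity`-shape ⟹ `Smooth`-shape at `3/2`». -/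
theorem smooth_alc_incomparable :
    (¬ ((∀ x : ℝ, DifferentiableAt ℝ (fun x : ℝ => x + 1 + max (2 - x) 0 ^ 2 / 4) x) →
        ∀ m : ℝ, 1 < m →
          ((fun x : ℝ => x + 1 + max (2 - x) 0 ^ 2 / 4) m - (m + 1)) ^ 2 ≤
            ((fun x : ℝ => x + 1 + max (2 - x) 0 ^ 2 / 4) 1 - 2) *
              ((fun x : ℝ => x + 1 + max (2 - x) 0 ^ 2 / 4) (2 * m - 1) - 2 * m))) ∧
    ¬ ((∀ m : ℝ, 1 < m →
        ((fun x : ℝ => x + 1 + max (Real.exp (-2 * (x - 1))) (Real.exp (-(x - 1) - 1 / 2))) m - (m + 1)) ^ 2 ≤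
          ((fun x : ℝ => x + 1 + max (Real.exp (-2 * (x - 1))) (Real.exp (-(x - 1) - 1 / 2))) 1 - 2) *
            ((fun x : ℝ => x + 1 + max (Real.exp (-2 * (x - 1))) (Real.exp (-(x - 1) - 1 / 2))) (2 * m - 1)
              - 2 * m)) →
        DifferentiableAt ℝ
          (fun x : ℝ => x + 1 + max (Real.exp (-2 * (x - 1))) (Real.exp (-(x - 1) - 1 / 2))) (3 / 2)) :=
  ⟨fun h => tangentialWorld.2.2.2 (h tangentialWorld.2.2.1), fun h => kinkedWorld.2 (h kinkedWorld.1)⟩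

end Summit.MatrixMultiplication.MatrixMultiplication.Theorems.FarEdgeDescentSmoothWorlds

end
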